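import Mathlib
import Summits.Parity.Statement
import Summits.Parity.GeneralizedHardyLittlewood.Theses.HomothetyPencil
import Summits.Parity.GeneralizedHardyLittlewood.Theses.SiegelSpectrumSplit
import Literature.NumberTheory.Sieve.LinearEquationsInPrimesLocalObstruction
import Literature.NumberTheory.Sieve.AffineLatticeLocalDensities
import Summits.Parity.GeneralizedHardyLittlewood.Theorems.TelescopingWindowsLatticeShift

/-!
# HomothetyPencil — dictionary and the guard certificate (part 1 of 2)
(Theorems-grade port of the decomp-parity lens-4 g7 kernel onto the BORN items of
`route-Parity-HomothetyPencil`; crit-1 CLEARED HOME/STATUS.md l.436, CRITIC-LEDGER row 81, hand lane P5;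
hand HOME/decomp-parity-lens-4/g7/hand/HomothetyPencilNecessity.lean sha16 c19c2ffa5133a7f4, ENDORSED l.463,
split in two files by the cell's prover-class seat census-1 g10 for the 400-line Theorems lint)

Dictionary (data): `hlError Ψ K N` (the Hardy–Littlewood error of one datum), the homothety
`dilate q Ψ` (same linear parts, constants `× q`), the guard modulus `strideMod t L = primorial (max t L)`
and the guarded pencil `pencil θ P N = {{1 + P m : m ≤ ⌊N^θ⌋ / P}}`.  No `Prop` definitions (D-0026).

Guard certificate G2 (trap T15 immunity; the no-local-obstruction lemmas `localFactor_pos_of_lt` /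
`singularProduct_pos_iff_localFactor_pos` are the LANDED ones of `Theorems/TelescopingWindowsLatticeShift.lean`,
same lens lineage, imported by name): `localFactor_dilate_eq`, `singularProduct_pos_iff_dilate`,
`no_admissible_dilate_of_obstructed` — a guarded dilation preserves every local factor at `p ≤ max t L`
and admissibility: no obstructed-neighbour witness along the pencil.  Part 2
(`HomothetyPencilNecessity.lean`) carries sufficiency beneath FU ∧ FL, necessity from GHL and the cone.
-/

namespace Summit.Parity.GeneralizedHardyLittlewood.Theses.HomothetyPencil

open Finset
open Literature.NumberTheory.Sieve hiding GeneralizedHardyLittlewood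
open Summit.Parity.GeneralizedHardyLittlewood.TelescopingWindowsLatticeShift (localFactor_pos_of_lt
  singularProduct_pos_iff_localFactor_pos)

noncomputable section

/-! ## §1 Dictionary -/

/-- The Hardy–Littlewood error of one datum: `E(Ψ,K,N) = ∑_{n∈K∩ℤ^d} ∏ Λ(ψ_i(n)) − β_∞(Ψ,K)·𝔖(Ψ)`. -/
def hlError {d t : ℕ} (Ψ : Fin t → AffLinForm d) (K : Set (Fin d → ℝ)) (N : ℕ) : ℝ :=
  vonMangoldtSum Ψ K N - archFactor Ψ K * singularProduct Ψ

/-- The homothety `q·Ψ`: same linear parts, every constant term multiplied by `q`. -/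
def dilate {d t : ℕ} (q : ℕ) (Ψ : Fin t → AffLinForm d) : Fin t → AffLinForm d :=
  fun i => ⟨(Ψ i).coeff, (q : ℤ) * (Ψ i).const⟩

/-- The obstruction-preserving guard modulus `P(t,L) = primorial (max t L)` (guard G2). -/
def strideMod (t L : ℕ) : ℕ := primorial (max t L)

/-- The guarded pencil of dilation factors at scale `N^θ`: `q = 1 + P m`, `0 ≤ m ≤ ⌊N^θ⌋ / P`. -/
def pencil (θ : ℝ) (P N : ℕ) : Finset ℕ :=
  (Finset.range (⌊(N : ℝ) ^ θ⌋₊ / P + 1)).image (fun m : ℕ => 1 + P * m)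

/-- The linear parts of a dilation are those of `Ψ`. -/
@[simp] theorem dilate_coeff {d t : ℕ} (q : ℕ) (Ψ : Fin t → AffLinForm d) (i : Fin t) :
    (dilate q Ψ i).coeff = (Ψ i).coeff := rfl

/-- The constants of `dilate q Ψ` are `q` times those of `Ψ`. -/
@[simp] theorem dilate_const {d t : ℕ} (q : ℕ) (Ψ : Fin t → AffLinForm d) (i : Fin t) :
    (dilate q Ψ i).const = (q : ℤ) * (Ψ i).const := rfl

/-- `dilate 1 Ψ = Ψ`. -/
@[simp] theorem dilate_one {d t : ℕ} (Ψ : Fin t → AffLinForm d) : dilate 1 Ψ = Ψ := by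
  funext i
  simp [dilate]

/-- Evaluation of a dilated form: same linear part, constant `× q`. -/
theorem eval_dilate {d t : ℕ} (q : ℕ) (Ψ : Fin t → AffLinForm d) (i : Fin t) (n : Fin d → ℤ) :
    (dilate q Ψ i).eval n = (∑ j, (Ψ i).coeff j * n j) + (q : ℤ) * (Ψ i).const := rfl

/-- Evaluation of an affine-linear form, spelled out. -/
theorem eval_eq {d : ℕ} (ψ : AffLinForm d) (n : Fin d → ℤ) :
    ψ.eval n = (∑ j, ψ.coeff j * n j) + ψ.const := rfl

/-- Dilation by `q ≠ 0` preserves non-degeneracy. -/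
theorem isNondegenerateSystem_dilate {d t : ℕ} {Ψ : Fin t → AffLinForm d}
    (hΨ : IsNondegenerateSystem Ψ) {q : ℕ} (hq : q ≠ 0) : IsNondegenerateSystem (dilate q Ψ) := by
  refine ⟨fun i => hΨ.1 i, fun i j hij a b hab => hΨ.2 i j hij a b ?_⟩
  have h0 := hab 0
  simp only [eval_dilate, Pi.zero_apply, mul_zero, Finset.sum_const_zero, zero_add] at h0
  have hq' : (q : ℤ) ≠ 0 := by exact_mod_cast hq
  have hconst : a * (Ψ i).const = b * (Ψ j).const :=
    mul_left_cancel₀ hq' (by linear_combination h0)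
  intro n
  have h1 := hab n
  simp only [eval_dilate] at h1
  rw [eval_eq, eval_eq]
  linear_combination h1 - h0 + hconst

/-- `‖Ψ‖_N ≤ ‖Ψ‖_1` for `N ≥ 1`. -/
theorem affLinSize_le_affLinSize_one {d t : ℕ} (Ψ : Fin t → AffLinForm d) {N : ℕ} (hN : 1 ≤ N) :
    affLinSize Ψ N ≤ affLinSize Ψ 1 := by
  have hN' : (1 : ℝ) ≤ N := by exact_mod_cast hN
  unfold affLinSize
  have hconst : ∑ i, |((Ψ i).const : ℝ) / N| ≤ ∑ i, |((Ψ i).const : ℝ) / 1| := by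
    refine Finset.sum_le_sum fun i _ => ?_
    rw [div_one, abs_div, Nat.abs_cast]
    exact div_le_self (abs_nonneg _) hN'
  linarith

/-- `‖q·Ψ‖_N ≤ 2‖Ψ‖_1` for `q ≤ 2N`. -/
theorem affLinSize_dilate_le {d t : ℕ} (Ψ : Fin t → AffLinForm d) {q N : ℕ} (hN : 0 < N)
    (hq : q ≤ 2 * N) : affLinSize (dilate q Ψ) N ≤ 2 * affLinSize Ψ 1 := by
  have hN' : (0 : ℝ) < N := by exact_mod_cast hN
  have hqN : (q : ℝ) / N ≤ 2 := by
    rw [div_le_iff₀ hN']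
    exact_mod_cast hq
  unfold affLinSize
  simp only [dilate_coeff, dilate_const, div_one]
  have hconst : ∑ i, |(((q : ℤ) * (Ψ i).const : ℤ) : ℝ) / N| ≤ 2 * ∑ i, |((Ψ i).const : ℝ)| := by
    rw [Finset.mul_sum]
    refine Finset.sum_le_sum fun i _ => ?_
    have : (((q : ℤ) * (Ψ i).const : ℤ) : ℝ) / N = ((q : ℝ) / N) * ((Ψ i).const : ℝ) := by
      push_cast
      ring
    rw [this, abs_mul, abs_of_nonneg (by positivity : (0 : ℝ) ≤ (q : ℝ) / N)]
    exact mul_le_mul_of_nonneg_right hqN (abs_nonneg _)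
  have hnn : 0 ≤ ∑ i, ∑ j, |((Ψ i).coeff j : ℝ)| :=
    Finset.sum_nonneg fun _ _ => Finset.sum_nonneg fun _ _ => abs_nonneg _
  linarith

/-- Membership in the guarded pencil: `q = 1 + P m` with `m` in the window. -/
theorem mem_pencil {θ : ℝ} {P N q : ℕ} :
    q ∈ pencil θ P N ↔ ∃ m, m < ⌊(N : ℝ) ^ θ⌋₊ / P + 1 ∧ 1 + P * m = q := by
  unfold pencil
  rw [Finset.mem_image]
  simp only [Finset.mem_range]

/-- The trivial dilation `q = 1` lies on every pencil. -/
theorem one_mem_pencil {θ : ℝ} {P N : ℕ} : 1 ∈ pencil θ P N :=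
  mem_pencil.mpr ⟨0, Nat.succ_pos _, by simp⟩

/-- The pencil is nonempty. -/
theorem pencil_card_pos {θ : ℝ} {P N : ℕ} : 0 < (pencil θ P N).card :=
  Finset.card_pos.mpr ⟨1, one_mem_pencil⟩

/-- The window length `⌊N^θ⌋₊` is at most `N` when `θ ≤ 1`, `N ≥ 1`. -/
theorem windowLen_le {θ : ℝ} (hθ : θ ≤ 1) {N : ℕ} (hN : 1 ≤ N) : ⌊(N : ℝ) ^ θ⌋₊ ≤ N := by
  have hN' : (1 : ℝ) ≤ N := by exact_mod_cast hN
  have h : (⌊(N : ℝ) ^ θ⌋₊ : ℝ) ≤ N :=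
    calc (⌊(N : ℝ) ^ θ⌋₊ : ℝ) ≤ (N : ℝ) ^ θ := Nat.floor_le (Real.rpow_nonneg (by positivity) θ)
      _ ≤ N := Real.rpow_le_self_of_one_le hN' hθ
  exact_mod_cast h

/-- Members of the pencil satisfy `1 ≤ q ≤ 2N` (`θ ≤ 1`, `N ≥ 1`). -/
theorem pencil_bounds {θ : ℝ} (hθ : θ ≤ 1) {P N q : ℕ} (hN : 1 ≤ N) (hq : q ∈ pencil θ P N) :
    1 ≤ q ∧ q ≤ 2 * N := by
  obtain ⟨m, hm, rfl⟩ := mem_pencil.mp hq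
  have hm' : m ≤ ⌊(N : ℝ) ^ θ⌋₊ / P := Nat.lt_succ_iff.mp hm
  have h1 : P * m ≤ ⌊(N : ℝ) ^ θ⌋₊ :=
    le_trans (Nat.mul_le_mul_left P hm') (Nat.mul_div_le _ _)
  have h2 := windowLen_le hθ hN
  constructor <;> omega

/-- The guard: every member of the pencil is `≡ 1 (mod P)`. -/
theorem strideMod_dvd_sub_one {θ : ℝ} {P N q : ℕ} (hq : q ∈ pencil θ P N) : P ∣ q - 1 := by
  obtain ⟨m, -, rfl⟩ := mem_pencil.mp hq
  exact ⟨m, by omega⟩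

/-! ## §2 The G2 certificate: guarded dilations preserve admissibility EXACTLY (trap T15) -/

/-- Local factors are invariant under dilation by `q ≡ 1 (mod p)`. -/
theorem localFactor_dilate_eq {d t : ℕ} {p : ℕ} (Ψ : Fin t → AffLinForm d) {q : ℕ}
    (hpq : (p : ℤ) ∣ (q : ℤ) - 1) : localFactor (dilate q Ψ) p = localFactor Ψ p := by
  unfold localFactor
  congr 1
  refine Finset.sum_congr rfl fun n _ => Finset.prod_congr rfl fun i _ => ?_
  refine (localVonMangoldt_congr ?_).symm
  rw [eval_dilate, eval_eq]
  have : (∑ j, (Ψ i).coeff j * (fun k => ((n k : ℕ) : ℤ)) j) + (q : ℤ) * (Ψ i).const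
      - ((∑ j, (Ψ i).coeff j * (fun k => ((n k : ℕ) : ℤ)) j) + (Ψ i).const)
      = ((q : ℤ) - 1) * (Ψ i).const := by ring
  rw [this]
  exact Dvd.dvd.mul_right hpq _

/-- **G2, local form.**  For `P(t,L) ∣ q − 1`, `q ≥ 1`: `β_p(Ψ) > 0 ↔ β_p(q·Ψ) > 0` at every prime. -/
theorem localFactor_pos_iff_dilate {d t L : ℕ} {Ψ : Fin t → AffLinForm d}
    (hΨ : IsNondegenerateSystem Ψ) {M : ℝ} (hL : affLinSize Ψ M ≤ L) {q : ℕ} (hq1 : 1 ≤ q)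
    (hq : strideMod t L ∣ q - 1) {p : ℕ} (hp : p.Prime) :
    0 < localFactor Ψ p ↔ 0 < localFactor (dilate q Ψ) p := by
  by_cases hpw : p ≤ max t L
  · have h1 : p ∣ q - 1 := (hp.dvd_primorial_iff.mpr hpw).trans hq
    have hpq : (p : ℤ) ∣ (q : ℤ) - 1 := by
      have h2 := Int.natCast_dvd_natCast.mpr h1
      rwa [Nat.cast_sub hq1, Nat.cast_one] at h2
    rw [localFactor_dilate_eq Ψ hpq]
  · push Not at hpw
    have htp : t < p := lt_of_le_of_lt (le_max_left _ _) hpw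
    have hLp : L < p := lt_of_le_of_lt (le_max_right _ _) hpw
    have hb : ∀ i' k, ((Ψ i').coeff k).natAbs ≤ L := fun i' k =>
      natAbs_coeff_le_of_affLinSize_le hL i' k
    have hb' : ∀ i' k, ((dilate q Ψ i').coeff k).natAbs ≤ L := fun i' k => hb i' k
    have hne' : ∀ i', (dilate q Ψ i').coeff ≠ 0 := fun i' => hΨ.1 i'
    exact ⟨fun _ => localFactor_pos_of_lt hp _ hne' hb' hLp htp,
      fun _ => localFactor_pos_of_lt hp _ hΨ.1 hb hLp htp⟩

/-- **G2 CERTIFICATE (trap T15 defused).**  A guarded dilation (`q ≥ 1`, `P(t,L) ∣ q − 1`) of a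
non-degenerate `Ψ` with `‖Ψ‖_M ≤ L` preserves admissibility EXACTLY: `0 < 𝔖(Ψ) ↔ 0 < 𝔖(q·Ψ)`. -/
theorem singularProduct_pos_iff_dilate {d t L : ℕ} {Ψ : Fin t → AffLinForm d}
    (hΨ : IsNondegenerateSystem Ψ) {M : ℝ} (hL : affLinSize Ψ M ≤ L) {q : ℕ} (hq1 : 1 ≤ q)
    (hq : strideMod t L ∣ q - 1) :
    0 < singularProduct Ψ ↔ 0 < singularProduct (dilate q Ψ) := by
  have hΨ' := isNondegenerateSystem_dilate hΨ (by omega : q ≠ 0)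
  rw [singularProduct_pos_iff_localFactor_pos hΨ, singularProduct_pos_iff_localFactor_pos hΨ']
  exact forall_congr' fun p => forall_congr' fun hp => localFactor_pos_iff_dilate hΨ hL hq1 hq hp

/-- T15 test, first instantiation («admissible system, obstructed comparand»): impossible on the pencil. -/
theorem no_obstructed_dilate {d t L : ℕ} {Ψ : Fin t → AffLinForm d}
    (hΨ : IsNondegenerateSystem Ψ) {M : ℝ} (hL : affLinSize Ψ M ≤ L) (hadm : 0 < singularProduct Ψ)
    {θ : ℝ} {N q : ℕ} (hq : q ∈ pencil θ (strideMod t L) N) : 0 < singularProduct (dilate q Ψ) := by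
  obtain ⟨m, -, rfl⟩ := mem_pencil.mp hq
  exact (singularProduct_pos_iff_dilate hΨ hL (by omega) ⟨m, by omega⟩).mp hadm

/-- T15 test, second instantiation («obstructed system, admissible comparand»): impossible on the pencil. -/
theorem no_admissible_dilate_of_obstructed {d t L : ℕ} {Ψ : Fin t → AffLinForm d}
    (hΨ : IsNondegenerateSystem Ψ) {M : ℝ} (hL : affLinSize Ψ M ≤ L) (hobs : singularProduct Ψ = 0)
    {θ : ℝ} {N q : ℕ} (hq : q ∈ pencil θ (strideMod t L) N) : singularProduct (dilate q Ψ) = 0 := by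
  obtain ⟨m, -, rfl⟩ := mem_pencil.mp hq
  have hΨ' := isNondegenerateSystem_dilate hΨ (by omega : 1 + strideMod t L * m ≠ 0)
  have hnn : 0 ≤ singularProduct (dilate (1 + strideMod t L * m) Ψ) :=
    ge_of_tendsto (tendsto_singularProductPartial_holds d t _ hΨ')
      (Filter.Eventually.of_forall fun x => Finset.prod_nonneg fun p _ => localFactor_nonneg _ p)
  rcases hnn.lt_or_eq with h | h
  · exact absurd ((singularProduct_pos_iff_dilate hΨ hL (by omega) ⟨m, by omega⟩).mpr h)
      (by rw [hobs]; exact lt_irrefl 0)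
  · exact h.symm

end

end Summit.Parity.GeneralizedHardyLittlewood.Theses.HomothetyPencil
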